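import Literature.Barriers.CriticalPhenomena.TimarBoxesGood
import Literature.Barriers.CriticalPhenomena.TimarHeavyClustersErgodic
import HarnessLib

/-!
# Timár 2006, proof of Thm. 4.3: measurability of "light"/"nice", the ball-exhaustion limit, and
# the deterministic inclusions "nice ⟹ good" — PROVED

Barrier catalogue `Literature/Barriers/CriticalPhenomena/`; continues `TimarBoxesGood.lean`
towards `Timar2006_noInfiniteLightClusters_holds`. Á. Timár, Ann. Probab. 34 (2006) 2344–2364,
proof of Thm. 4.3, p. 2354: the events `F(x)` ("`C(x)` is infinite, light and nice") and the
choice of the radius `r`: "we choose `r` to satisfy the second property. This can always be done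
since the intersection of a light cluster with `G(ℓ_{j+i}, ℓ_j]` is finite by definition and
thus the probability that it intersects a large sphere around `o` can be made arbitrarily small."
Proved here (all for the cluster `C(o)` of a fixed vertex under any measure on configurations):

* measurability of `{C(o) ⊆ S}`, of `{C(o) ∩ T ⊄ B}` and of `{C(o) infinite}`
  (`measurableSet_*`; "`C(o)` is heavy / light" is `measurableSet_isHeavy_openCluster` of
  `TimarHeavyClustersErgodic.lean`);
* `tendsto_measure_inter_not_subset_graphBall` — if on a measurable event `L` the set `C(o) ∩ T`
  is finite, then `μ(L ∩ {C(o) ∩ T ⊄ B(o, r)}) → 0` as `r → ∞` (continuity from above; a finite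
  set lies in some ball);
* the deterministic inclusions behind "good with probability `> q/2`" (p. 2354, "First, we choose
  `i`, using Lemma 4.2 … Then we choose `r`"), for the NICE event `C(o) ⊆ {o} ∪ {w ≤ Δ}`
  ("`C(x)` is nice if `C(x) = C(x)|G′(x)`"): `timarSealed_of_nice` (niceness + the part of `C(o)`
  above `Δ^{n+3}` inside `B(o, r+1)` ⟹ the box component is sealed),
  `regionCluster_subset_timarBoxCluster_of_nice` / `subset_timarCountSet_of_nice` (then the region
  cluster `C_{n+1}` of Lemma 4.2 lies in the box component, so its slab vertices with an open long
  edge are counted), and the counting lemma `exists_subset_forall_not_of_card_filter_lt`.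

## References

* Á. Timár, Ann. Probab. 34 (2006) 2344–2364 (arXiv:math/0702875), §4, proof of Thm. 4.3,
  p. 2354. [Timar2006]
-/

noncomputable section

namespace Literature.Barriers.CriticalPhenomena

open _root_.MeasureTheory _root_.Filter Literature.Probability.Percolation
open scoped _root_.ENNReal _root_.Topology

variable {V : Type*}

section Measurability

variable [Countable V] (G : SimpleGraph V) (o : V)

/-! `{v ∈ C(o)}` (`measurableSet_openConn_holds`), the total weight `ω ↦ W(C(o))` and
"`C(o)` is heavy" (`measurable_setWeight_openCluster`, `measurableSet_isHeavy_openCluster`,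
`TimarHeavyClustersErgodic.lean`) are measurable; we add `{C(o) ⊆ S}`, `{C(o) ∩ T ⊄ B}`,
`{C(o) infinite}`. -/

omit G in
/-- `{C(o) ⊆ S}` is measurable. [folklore] -/
theorem measurableSet_openCluster_subset (S : Set V) :
    MeasurableSet {ω : BondConfig V | openCluster ω o ⊆ S} := by
  have h : {ω : BondConfig V | openCluster ω o ⊆ S} = ⋂ v ∈ Sᶜ, {ω | v ∈ openCluster ω o}ᶜ := by
    ext ω
    simp only [Set.mem_setOf_eq, Set.mem_iInter, Set.mem_compl_iff]
    exact ⟨fun h v hv hvC => hv (h hvC), fun h v hvC => by_contra fun hv => h v hv hvC⟩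
  rw [h]
  exact MeasurableSet.biInter (Set.to_countable _) fun v _ => (measurableSet_openConn_holds o v).compl

omit G in
/-- `{C(o) ∩ T ⊄ B}` is measurable. [folklore] -/
theorem measurableSet_not_subset (T B : Set V) :
    MeasurableSet {ω : BondConfig V | ¬ (openCluster ω o ∩ T ⊆ B)} := by
  have h : {ω : BondConfig V | ¬ (openCluster ω o ∩ T ⊆ B)} =
      ⋃ v ∈ T \ B, {ω | v ∈ openCluster ω o} := by
    ext ω
    simp only [Set.mem_setOf_eq, Set.not_subset, Set.mem_iUnion, Set.mem_sdiff, Set.mem_inter_iff,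
      exists_prop]
    constructor
    · rintro ⟨v, ⟨hvC, hvT⟩, hvB⟩; exact ⟨v, ⟨hvT, hvB⟩, hvC⟩
    · rintro ⟨v, ⟨hvT, hvB⟩, hvC⟩; exact ⟨v, ⟨hvC, hvT⟩, hvB⟩
  rw [h]
  exact MeasurableSet.biUnion (Set.to_countable _) fun v _ => measurableSet_openConn_holds o v

omit G in
/-- `{C(o) infinite}` is measurable. [folklore] -/
theorem measurableSet_infinite_openCluster :
    MeasurableSet {ω : BondConfig V | (openCluster ω o).Infinite} :=
  measurableSet_percolatesAt_holds o

end Measurability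

/-! ### Ball exhaustion -/

section Exhaustion

variable {G : SimpleGraph V} (hconn : G.Connected) (o : V)
include hconn

/-- **A finite part of the cluster lies in a large ball with high probability**: if on the
measurable event `L` the set `C(o) ∩ T` is finite, then `μ(L ∩ {C(o) ∩ T ⊄ B(o, r)}) → 0` as
`r → ∞` ("the probability that it intersects a large sphere around `o` can be made arbitrarily
small", p. 2354). [cite: Timar2006, §4 (proof of Thm. 4.3: the choice of r)] -/
theorem tendsto_measure_inter_not_subset_graphBall [Countable V] (μ : Measure (BondConfig V))
    [IsFiniteMeasure μ] {L : Set (BondConfig V)} (hL : MeasurableSet L) (T : Set V)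
    (hfin : ∀ ω ∈ L, (openCluster ω o ∩ T).Finite) :
    Tendsto (fun r : ℕ => μ (L ∩ {ω | ¬ (openCluster ω o ∩ T ⊆ graphBall G o r)})) atTop (𝓝 0) := by
  set s : ℕ → Set (BondConfig V) := fun r => L ∩ {ω | ¬ (openCluster ω o ∩ T ⊆ graphBall G o r)}
    with hs
  have hanti : Antitone s := by
    intro r r' hrr' ω hω
    exact ⟨hω.1, fun hsub => hω.2 (hsub.trans (graphBall_mono G o hrr'))⟩
  have hempty : ⋂ r, s r = ∅ := by
    refine Set.eq_empty_of_forall_notMem fun ω hω => ?_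
    rw [Set.mem_iInter] at hω
    obtain ⟨r, hr⟩ := exists_subset_graphBall_of_finite G hconn o (hfin ω (hω 0).1)
    exact (hω r).2 hr
  have h := tendsto_measure_iInter_atTop (μ := μ)
    (fun r => (hL.inter (measurableSet_not_subset o T _)).nullMeasurableSet) hanti
    ⟨0, measure_ne_top μ _⟩
  rwa [hempty, measure_empty] at h

/-- Eventually form: for every `ε > 0`, for all large `r`,
`μ(L ∩ {C(o) ∩ T ⊄ B(o, r)}) ≤ ε`. [cite: Timar2006, §4 (proof of Thm. 4.3: the choice of r)] -/
theorem eventually_measure_inter_not_subset_graphBall_le [Countable V] (μ : Measure (BondConfig V))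
    [IsFiniteMeasure μ] {L : Set (BondConfig V)} (hL : MeasurableSet L) (T : Set V)
    (hfin : ∀ ω ∈ L, (openCluster ω o ∩ T).Finite) {ε : ℝ≥0∞} (hε : 0 < ε) :
    ∀ᶠ r : ℕ in atTop, μ (L ∩ {ω | ¬ (openCluster ω o ∩ T ⊆ graphBall G o r)}) ≤ ε :=
  ((tendsto_measure_inter_not_subset_graphBall hconn o μ hL T hfin).eventually
    (eventually_le_nhds hε)).mono fun _ h => h

end Exhaustion

/-! ### On a nice light cluster the box of `o` is good: deterministic inclusions -/

section Nice

variable {G : SimpleGraph V} [G.LocallyFinite] {o : V}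
variable (hconn : G.Connected) (htr : IsGraphTransitive G) (hU : ¬ IsGraphUnimodular G)
include hconn htr hU

omit htr hU in
/-- **Niceness and a ball bound give sealing**: if `C(o) ⊆ {o} ∪ {w ≤ Δ}` and
`C(o) ∩ {w > Δ^{n+3}} ⊆ B(o, r+1)`, then the box component of `o` of radius `r + 1` above
`Δ^{n+3} · w(o)` is sealed. [cite: Timar2006, §4 (proof of Thm. 4.3: nice clusters and the choice of r)] -/
theorem timarSealed_of_nice {ω : BondConfig V} {n r : ℕ}
    (hnice : openCluster ω o ⊆ insert o {v | autWeight G o v ≤ minNbrWeight G o})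
    (hball : openCluster ω o ∩ {v | minNbrWeight G o ^ (n + 3) < autWeight G o v} ⊆
      graphBall G o (r + 1)) :
    TimarSealed G o o (r + 1) (minNbrWeight G o ^ (n + 3) * autWeight G o o) ω := by
  rw [autWeight_self G hconn o, mul_one]
  intro v hv _ u hadj hopen hβ
  have hvC : v ∈ openCluster ω o := timarBoxCluster_subset_openCluster o _ _ ω hv
  have huC : u ∈ openCluster ω o :=
    hvC.trans (SimpleGraph.Adj.reachable ((openGraph_adj ω v u).2 ⟨hopen, hadj.ne⟩))
  rcases hnice huC with rfl | hu
  · exact self_mem_timarBox _ _ _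
  · refine Or.inr ⟨hball ⟨huC, hβ⟩, hβ, ?_⟩
    rwa [autWeight_self G hconn, mul_one]

/-- **Niceness and a ball bound put the region cluster inside the box component**: if
`C(o) ⊆ {o} ∪ {w ≤ Δ}` and `C(o) ∩ {w > Δ^{n+2}} ⊆ B(o, r)`, then the cluster `C_{n+1}` of `o`
above `Δ^{n+2}` (`regionCluster` for the grid `t_j = Δ^j`) lies in the box component of `o` of
radius `r` above `Δ^{n+2} · w(o)`. [cite: Timar2006, §4 (proof of Thm. 4.3: the open component of o in B_o(i; r) on a nice cluster)] -/
theorem regionCluster_subset_timarBoxCluster_of_nice {ω : BondConfig V} {n r : ℕ}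
    (hnice : openCluster ω o ⊆ insert o {v | autWeight G o v ≤ minNbrWeight G o})
    (hball : openCluster ω o ∩ {v | minNbrWeight G o ^ (n + 2) < autWeight G o v} ⊆
      graphBall G o r) :
    regionCluster G o (fun i => minNbrWeight G o ^ i) (n + 1) ω ⊆
      timarBoxCluster G o o r (minNbrWeight G o ^ (n + 2) * autWeight G o o) ω := by
  -- every vertex of `C_{n+1}` lies in the box
  have hbox : regionCluster G o (fun i => minNbrWeight G o ^ i) (n + 1) ω ⊆
      timarBox G o o r (minNbrWeight G o ^ (n + 2) * autWeight G o o) := by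
    intro v hv
    have hvC : v ∈ openCluster ω o := regionCluster_subset_openCluster (n + 1) ω hv
    have ho : o ∈ tregion G o (fun i => minNbrWeight G o ^ i) (n + 1) := by
      show minNbrWeight G o ^ (n + 1 + 1) < autWeight G o o
      rw [autWeight_self G hconn o]
      exact pow_lt_one' (minNbrWeight_lt_one hconn htr hU o) (by omega)
    have hvR : minNbrWeight G o ^ (n + 2) < autWeight G o v := regionCluster_subset_tregion ho ω hv
    rcases hnice hvC with rfl | hvw
    · exact self_mem_timarBox _ _ _
    · refine Or.inr ⟨hball ⟨hvC, hvR⟩, by rwa [autWeight_self G hconn o, mul_one], ?_⟩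
      rwa [autWeight_self G hconn o, mul_one]
  -- hence open region steps are open box steps
  intro v hv
  rw [regionCluster, mem_openClusterIn_iff] at hv
  obtain ⟨p⟩ := hv
  suffices h : ∀ {a b : V} (_ : (openGraph ω ⊓ withinGraph G
      (tregion G o (fun i => minNbrWeight G o ^ i) (n + 1))).Walk a b),
      a ∈ regionCluster G o (fun i => minNbrWeight G o ^ i) (n + 1) ω →
      a ∈ timarBoxCluster G o o r (minNbrWeight G o ^ (n + 2) * autWeight G o o) ω →
      b ∈ timarBoxCluster G o o r (minNbrWeight G o ^ (n + 2) * autWeight G o o) ω from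
    h p (self_mem_openClusterIn _ ω o) (self_mem_timarBoxCluster o r _ ω)
  intro a b q
  induction q with
  | nil => exact fun _ h => h
  | cons hadj _ ih =>
    intro haR haK
    rw [SimpleGraph.inf_adj, openGraph_adj, withinGraph_adj] at hadj
    obtain ⟨⟨hopen, -⟩, hG, haT, hbT⟩ := hadj
    have hbR := mem_openClusterIn_of_adj haR ⟨hG, haT, hbT⟩ hopen
    exact ih hbR (mem_timarBoxCluster_of_adj haK hG hopen (hbox hbR))

/-- Hence, under the same hypotheses, **every vertex of `C_{n+1} ∩ G(ℓ_{n+2}, ℓ_{n+1}]` with an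
open long edge is counted** by the good event of `o` (depth `n`, radius `r`).
[cite: Timar2006, §4 (proof of Thm. 4.3: "|C(o) ∩ G(ℓ_{i+1}, ℓ_i]| ≥ k … the open component of o in B_o(i; r) is good")] -/
theorem subset_timarCountSet_of_nice {ω : BondConfig V} {n r : ℕ}
    (hnice : openCluster ω o ⊆ insert o {v | autWeight G o v ≤ minNbrWeight G o})
    (hball : openCluster ω o ∩ {v | minNbrWeight G o ^ (n + 2) < autWeight G o v} ⊆
      graphBall G o r) :
    {y | y ∈ regionCluster G o (fun i => minNbrWeight G o ^ i) (n + 1) ω ∩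
        tslab G o (fun i => minNbrWeight G o ^ i) (n + 1) ∧ TimarSteepOpen G o y ω} ⊆
      timarCountSet G o n r o ω := by
  rintro y ⟨⟨hyR, hyL⟩, hst⟩
  refine ⟨regionCluster_subset_timarBoxCluster_of_nice hconn htr hU hnice hball hyR, ?_, hst⟩
  rw [autWeight_self G hconn o, mul_one]
  exact hyL.2

end Nice

/-! ### A counting lemma -/

/-- If fewer than `k` elements of the finite set `b` satisfy `P`, then some subset of `b` of
size `|b| − (k − 1)` consists of elements violating `P` (take any subset of the failures of the
right size). [folklore] -/
theorem exists_subset_forall_not_of_card_filter_lt {α : Type*} [DecidableEq α] (b : Finset α)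
    (P : α → Prop) [DecidablePred P] {k : ℕ} (h : (b.filter P).card < k) :
    ∃ S ∈ b.powersetCard (b.card - (k - 1)), ∀ y ∈ S, ¬ P y := by
  have hcard : b.card - (k - 1) ≤ (b.filter fun y => ¬ P y).card := by
    have h1 : (b.filter P).card + (b.filter fun y => ¬ P y).card = b.card :=
      Finset.card_filter_add_card_filter_not P
    omega
  obtain ⟨S, hS, hSc⟩ := Finset.exists_subset_card_eq hcard
  refine ⟨S, Finset.mem_powersetCard.2 ⟨hS.trans (Finset.filter_subset _ _), hSc⟩, fun y hy => ?_⟩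
  exact (Finset.mem_filter.1 (hS hy)).2

end Literature.Barriers.CriticalPhenomena

end
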